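import Summits.AtomisticToContinuum.BoseEinsteinCondensation.Theorems.BECLaplacianL1ModeCountingL1Slices
import HarnessLib

/-!
# Route BECLaplacianL1, item `ModeCountingL1` — helper 3/3: the exponent-2 infrared bound

Support file for `Summit.AtomisticToContinuum.BoseEinsteinCondensation.Theses.BECLaplacianL1.ModeCountingL1`
(stmt-AtomisticToContinuum-9012), concluding `BECLaplacianL1ModeCountingL1Slices.lean`:

* `integral_conj_cellWave_mul_kineticCoherence` — **Wiener–Khinchin for the kinetic coherence**:
  `∫_cell conj(e_p(r)) G_Ψ(r) dr = (n+1) L⁶ (4π²|p|²/L²) ∫_{cell^n} |ĉ_p(Ψ(·,Y))|² dY`;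
* `cellOccupation_planeWaveMode_eq_ofReal_integral` — the plane-wave occupation through the slice
  coefficients, `n_p = (n+1) L³ ∫_{cell^n} |ĉ_p(Ψ(·,Y))|² dY`;
* `ir_bound_of_kineticCoherence` — **the exponent-2 infrared bound from an `L¹` clustering norm**:
  `L³ · |2πp/L|² · n_p(Ψ) ≤ ‖G_Ψ‖_{L¹(cell)}` for every periodic trial state and every `p ∈ ℤ³`
  (`|∫ conj(e_p) G| ≤ ∫ |G|`), with `G_Ψ` inlined exactly as in the route items `KineticCoherenceL1`
  / `ModeCountingL1`. This is the infrared input of the mode count in `BECLaplacianL1ModeCountingL1.lean`: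
  the analogue, with a clustering norm in place of a susceptibility, of the reflection-positivity
  infrared bound of [KLS1988PRL].

No new definitions.

## References

* [LSSY2005] E. H. Lieb, R. Seiringer, J. P. Solovej, J. Yngvason, *The Mathematics of the Bose Gas
  and its Condensation*, Birkhäuser 2005, §1.2 (1.17)–(1.19) (one-particle density matrix, mode
  occupations, `tr γ = N`).
* [KLS1988PRL] T. Kennedy, E. H. Lieb, B. S. Shastry, Phys. Rev. Lett. 61 (1988) 2582 (infrared
  bound ⇒ long-range order by mode counting in `d = 3`).
-/

noncomputable section

open MeasureTheory Filter Complex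
open scoped ENNReal NNReal ComplexConjugate

namespace Summit.AtomisticToContinuum.BoseEinsteinCondensation.Theorems

namespace LaplacianModeCounting

open Literature.MathematicalPhysics.QuantumManyBody.BoseGas

variable {N n : ℕ} {L : ℝ}

/-! ## §4 The Fourier coefficients of the kinetic coherence and the infrared bound -/

section Coherence

variable (Ψ : PeriodicTrialState (n + 1) L)

/-- **Wiener–Khinchin for the kinetic coherence.** For a periodic trial state of `n+1` bosons,
`∫_cell conj(e_p(r)) G_Ψ(r) dr = (n+1) L⁶ (4π²|p|²/L²) ∫_{cell^n} |ĉ_p(Ψ(·,Y))|² dY`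
(`= L³ |2πp/L|² n_p`, see `ir_bound_of_kineticCoherence`). [cite: LSSY2005, §1.2 (1.17)] -/
theorem integral_conj_cellWave_mul_kineticCoherence (hL : 0 < L) (p : Fin 3 → ℤ) :
    ∫ r in cell L, conj (cellWave L p r) *
      ∑ i : Fin (n + 1), ∑ k : Fin 3, ∫ X in cellN (n + 1) L,
        fderiv ℝ Ψ.ψ (X + Pi.single i r) (Pi.single i (EuclideanSpace.single k (1 : ℝ))) *
          conj (fderiv ℝ Ψ.ψ X (Pi.single i (EuclideanSpace.single k (1 : ℝ)))) =
    (((n + 1 : ℝ) * ((L ^ 3) ^ 2 * (4 * Real.pi ^ 2 * (∑ k, (p k : ℝ) ^ 2) / L ^ 2) *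
        ∫ Y in cellN n L, ‖cellFourierCoeff L (fun y => Ψ.ψ (Matrix.vecCons y Y)) p‖ ^ 2) : ℝ) :
      ℂ) := by
  -- abbreviation for the first-slot terms
  set T : Fin 3 → Space → ℂ := fun k r => ∫ X in cellN (n + 1) L,
      fderiv ℝ Ψ.ψ (X + Pi.single 0 r) (Pi.single 0 (EuclideanSpace.single k (1 : ℝ))) *
        conj (fderiv ℝ Ψ.ψ X (Pi.single 0 (EuclideanSpace.single k (1 : ℝ)))) with hT
  set I : ℝ := ∫ Y in cellN n L, ‖cellFourierCoeff L (fun y => Ψ.ψ (Matrix.vecCons y Y)) p‖ ^ 2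
    with hI
  -- Bose symmetry: `G(r) = (n+1) ∑ₖ T k r`
  have hG : ∀ r : Space, (∑ i : Fin (n + 1), ∑ k : Fin 3, ∫ X in cellN (n + 1) L,
      fderiv ℝ Ψ.ψ (X + Pi.single i r) (Pi.single i (EuclideanSpace.single k (1 : ℝ))) *
        conj (fderiv ℝ Ψ.ψ X (Pi.single i (EuclideanSpace.single k (1 : ℝ))))) =
      (n + 1 : ℂ) * ∑ k : Fin 3, T k r := by
    intro r
    simp only [coherenceTerm_eq_slot_zero Ψ, hT]
    rw [Finset.sum_const, Finset.card_univ, Fintype.card_fin, nsmul_eq_mul]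
    push_cast
    rfl
  -- integrability of `r ↦ conj(e_p(r)) T k r` on the cell
  have hTint : ∀ k : Fin 3, Integrable (fun r => conj (cellWave L p r) * T k r)
      (volume.restrict (cell L)) := by
    intro k
    have h := (integrable_conj_cellWave_mul_slicePairing Ψ hL k p).integral_prod_left
    refine h.congr (Eventually.of_forall fun r => ?_)
    simp only [Function.uncurry_apply_pair, hT]
    rw [integral_const_mul, coherenceTerm_zero_eq_slices Ψ k r]
  -- the coefficient of each first-slot term
  have hTk : ∀ k : Fin 3, ∫ r in cell L, conj (cellWave L p r) * T k r =
      (((L ^ 3) ^ 2 * (4 * Real.pi ^ 2 * (p k : ℝ) ^ 2 / L ^ 2) * I : ℝ) : ℂ) := fun k =>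
    integral_conj_cellWave_mul_coherenceTerm_zero Ψ hL k p
  -- summation over the axes
  have hsum : ∑ k : Fin 3, (L ^ 3) ^ 2 * (4 * Real.pi ^ 2 * (p k : ℝ) ^ 2 / L ^ 2) * I =
      (L ^ 3) ^ 2 * (4 * Real.pi ^ 2 * (∑ k, (p k : ℝ) ^ 2) / L ^ 2) * I := by
    rw [Finset.mul_sum, Finset.sum_div, Finset.mul_sum, Finset.sum_mul]
  simp only [hG]
  calc ∫ r in cell L, conj (cellWave L p r) * ((n + 1 : ℂ) * ∑ k : Fin 3, T k r)
      = ∫ r in cell L, (n + 1 : ℂ) * ∑ k : Fin 3, conj (cellWave L p r) * T k r := by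
        congr 1
        funext r
        conv_lhs => rw [mul_left_comm, Finset.mul_sum]
    _ = (n + 1 : ℂ) * ∑ k : Fin 3, ∫ r in cell L, conj (cellWave L p r) * T k r := by
        rw [integral_const_mul, integral_finsetSum _ fun k _ => hTint k]
    _ = (n + 1 : ℂ) * ∑ k : Fin 3, (((L ^ 3) ^ 2 * (4 * Real.pi ^ 2 * (p k : ℝ) ^ 2 / L ^ 2) * I :
          ℝ) : ℂ) := by
        simp only [hTk]
    _ = _ := by
        rw [← Complex.ofReal_sum, hsum]
        push_cast
        ring

/-- **The plane-wave occupation through the slice coefficients**: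
`n_p = ⟨φ_p, γ_Ψ φ_p⟩ = (n+1) L³ ∫_{cell^n} |ĉ_p(Ψ(·,Y))|² dY` (as an `ℝ≥0∞` identity with a
Bochner integral; the integrand is bounded by `sup|Ψ|²`). [cite: LSSY2005, §1.2 (1.17)] -/
theorem cellOccupation_planeWaveMode_eq_ofReal_integral (hL : 0 < L) (p : Fin 3 → ℤ) :
    cellOccupation (n + 1) L (planeWaveMode L p) Ψ.ψ =
      (n + 1 : ℝ≥0∞) * (ENNReal.ofReal L ^ 3 * ENNReal.ofReal
        (∫ Y in cellN n L, ‖cellFourierCoeff L (fun y => Ψ.ψ (Matrix.vecCons y Y)) p‖ ^ 2)) := by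
  haveI : IsFiniteMeasure ((volume : Measure (Config n)).restrict (cellN n L)) :=
    isFiniteMeasure_restrict.2 (by
      rw [volume_cellN]; exact ENNReal.pow_ne_top (ENNReal.pow_ne_top ENNReal.ofReal_ne_top))
  obtain ⟨M, hM⟩ := Ψ.exists_norm_le hL
  have hM0 : 0 ≤ M := (norm_nonneg _).trans (hM 0)
  have hcont : Continuous Ψ.ψ := Ψ.contDiff.continuous
  -- the coefficient as a cell integral, measurable in `Y` and bounded by `M`
  have hrepr : ∀ Y : Config n, cellFourierCoeff L (fun y => Ψ.ψ (Matrix.vecCons y Y)) p =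
      ((L ^ 3)⁻¹ : ℝ) • ∫ x in cell L, conj (cellWave L p x) * Ψ.ψ (Matrix.vecCons x Y) :=
    fun Y => cellFourierCoeff_eq_integral hL _ p
  have hsm : StronglyMeasurable fun Y : Config n =>
      ∫ x in cell L, conj (cellWave L p x) * Ψ.ψ (Matrix.vecCons x Y) := by
    refine StronglyMeasurable.integral_prod_right' (ν := volume.restrict (cell L))
      (f := fun z : Config n × Space => conj (cellWave L p z.2) * Ψ.ψ (Matrix.vecCons z.2 z.1)) ?_
    refine Continuous.stronglyMeasurable ?_
    exact (Complex.continuous_conj.comp ((contDiff_cellWave L p).continuous.comp continuous_snd)).mul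
      (hcont.comp (continuous_snd.matrixVecCons continuous_fst))
  have hbound : ∀ Y : Config n, ‖cellFourierCoeff L (fun y => Ψ.ψ (Matrix.vecCons y Y)) p‖ ≤ M := by
    intro Y
    have hvol : volume (cell L) < ⊤ := by
      rw [volume_cell]; exact ENNReal.pow_lt_top ENNReal.ofReal_lt_top
    have h := norm_setIntegral_le_of_norm_le_const hvol (C := M)
      (f := fun x => conj (cellWave L p x) * Ψ.ψ (Matrix.vecCons x Y))
      (fun x _ => by rw [norm_mul, Complex.norm_conj, norm_cellWave, one_mul]; exact hM _)
    rw [measureReal_def, volume_cell, ENNReal.toReal_pow, ENNReal.toReal_ofReal hL.le] at h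
    rw [hrepr Y, norm_smul, Real.norm_of_nonneg (by positivity)]
    calc (L ^ 3)⁻¹ * ‖∫ x in cell L, conj (cellWave L p x) * Ψ.ψ (Matrix.vecCons x Y)‖
        ≤ (L ^ 3)⁻¹ * (M * L ^ 3) := by gcongr
      _ = M := by field_simp
  have hint : Integrable (fun Y : Config n =>
      ‖cellFourierCoeff L (fun y => Ψ.ψ (Matrix.vecCons y Y)) p‖ ^ 2)
      (volume.restrict (cellN n L)) := by
    refine Integrable.of_bound ?_ (M ^ 2) (Eventually.of_forall fun Y => ?_)
    · have h1 : (fun Y : Config n => ‖cellFourierCoeff L (fun y => Ψ.ψ (Matrix.vecCons y Y)) p‖ ^ 2) =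
          fun Y => ‖((L ^ 3)⁻¹ : ℝ) • ∫ x in cell L, conj (cellWave L p x) *
            Ψ.ψ (Matrix.vecCons x Y)‖ ^ 2 := funext fun Y => by rw [hrepr Y]
      rw [h1]
      exact ((hsm.const_smul ((L ^ 3)⁻¹ : ℝ)).measurable.norm.pow_const 2).aestronglyMeasurable
    · rw [Real.norm_of_nonneg (by positivity)]
      exact pow_le_pow_left₀ (norm_nonneg _) (hbound Y) 2
  rw [cellOccupation_succ]
  congr 1
  simp only [nnnorm_sq_integral_conj_planeWaveMode_mul hL]
  rw [lintegral_const_mul' _ _ (ENNReal.pow_ne_top ENNReal.ofReal_ne_top)]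
  congr 1
  simp only [coe_nnnorm_sq_eq_ofReal]
  exact (ofReal_integral_eq_lintegral_ofReal hint
    (Eventually.of_forall fun Y => by positivity)).symm

end Coherence

/-- From a Fourier coefficient to an `L¹` bound: if `∫_cell conj(e_p) G = R ≥ 0` then
`R ≤ ∫_cell |G|` (`|e_p| = 1`). [folklore] -/
theorem ofReal_le_lintegral_nnnorm_of_integral_eq {G : Space → ℂ} {R : ℝ} (hR : 0 ≤ R)
    {p : Fin 3 → ℤ} (hG : ∫ r in cell L, conj (cellWave L p r) * G r = (R : ℂ)) :
    ENNReal.ofReal R ≤ ∫⁻ r in cell L, (‖G r‖₊ : ℝ≥0∞) :=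
  calc ENNReal.ofReal R = ‖∫ r in cell L, conj (cellWave L p r) * G r‖ₑ := by
        rw [hG, ← ofReal_norm, Complex.norm_real, Real.norm_of_nonneg hR]
    _ ≤ ∫⁻ r in cell L, ‖conj (cellWave L p r) * G r‖ₑ := enorm_integral_le_lintegral_enorm _
    _ = ∫⁻ r in cell L, (‖G r‖₊ : ℝ≥0∞) := lintegral_congr fun r => by
        rw [enorm_mul, ← ofReal_norm (conj (cellWave L p r)), Complex.norm_conj, norm_cellWave,
          ENNReal.ofReal_one, one_mul, enorm_eq_nnnorm]

/-- **The exponent-2 infrared bound from the kinetic coherence.** For every periodic trial state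
`Ψ` of `N` bosons on the torus of side `L > 0` and every `p ∈ ℤ³`,
`L³ · |2πp/L|² · n_p(Ψ) ≤ ‖G_Ψ‖_{L¹(cell)}`, where `n_p = ⟨φ_p, γ_Ψ φ_p⟩` is the occupation of the
plane wave `φ_p` and `G_Ψ(r) = ∑ᵢ ∑ₖ ∫_{cell^N} ∂_{i,k}Ψ(X + r eᵢ) conj ∂_{i,k}Ψ(X) dX` the kinetic
coherence: `L³|2πp/L|² n_p = ∫_cell conj(e_p) G_Ψ ≤ ∫_cell |G_Ψ|`. [cite: LSSY2005, §1.2 (1.17)] -/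
theorem ir_bound_of_kineticCoherence (hL : 0 < L) (Ψ : PeriodicTrialState N L) (p : Fin 3 → ℤ) :
    ENNReal.ofReal L ^ 3 * fracDispersion 2 L p * cellOccupation N L (planeWaveMode L p) Ψ.ψ ≤
      ∫⁻ r in cell L, (‖∑ i : Fin N, ∑ k : Fin 3, ∫ X in cellN N L,
        fderiv ℝ Ψ.ψ (X + Pi.single i r) (Pi.single i (EuclideanSpace.single k (1 : ℝ))) *
          (starRingEnd ℂ) (fderiv ℝ Ψ.ψ X (Pi.single i (EuclideanSpace.single k (1 : ℝ))))‖₊ :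
            ℝ≥0∞) := by
  cases N with
  | zero => simp [cellOccupation, occupation]
  | succ n =>
    have hI0 : 0 ≤ ∫ Y in cellN n L,
        ‖cellFourierCoeff L (fun y => Ψ.ψ (Matrix.vecCons y Y)) p‖ ^ 2 :=
      integral_nonneg fun Y => by positivity
    have hR0 : 0 ≤ (n + 1 : ℝ) * ((L ^ 3) ^ 2 * (4 * Real.pi ^ 2 * (∑ k, (p k : ℝ) ^ 2) / L ^ 2) *
        ∫ Y in cellN n L, ‖cellFourierCoeff L (fun y => Ψ.ψ (Matrix.vecCons y Y)) p‖ ^ 2) := by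
      positivity
    -- the left-hand side as `ofReal` of the Fourier coefficient of `G_Ψ`
    have hn : ((n : ℝ≥0∞) + 1) = ENNReal.ofReal ((n : ℝ) + 1) := by
      rw [← ENNReal.ofReal_natCast, ← ENNReal.ofReal_one,
        ← ENNReal.ofReal_add (Nat.cast_nonneg n) zero_le_one]
    have hlhs : ENNReal.ofReal L ^ 3 * fracDispersion 2 L p *
        cellOccupation (n + 1) L (planeWaveMode L p) Ψ.ψ =
        ENNReal.ofReal ((n + 1 : ℝ) * ((L ^ 3) ^ 2 *
          (4 * Real.pi ^ 2 * (∑ k, (p k : ℝ) ^ 2) / L ^ 2) *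
            ∫ Y in cellN n L, ‖cellFourierCoeff L (fun y => Ψ.ψ (Matrix.vecCons y Y)) p‖ ^ 2)) := by
      rw [cellOccupation_planeWaveMode_eq_ofReal_integral Ψ hL p, fracDispersion_two,
        ← ENNReal.ofReal_pow hL.le, hn, ← ENNReal.ofReal_mul (by positivity),
        ← ENNReal.ofReal_mul (by positivity), ← ENNReal.ofReal_mul (by positivity),
        ← ENNReal.ofReal_mul (by positivity)]
      congr 1
      ring
    rw [hlhs]
    exact ofReal_le_lintegral_nnnorm_of_integral_eq hR0
      (integral_conj_cellWave_mul_kineticCoherence Ψ hL p)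


end LaplacianModeCounting

end Summit.AtomisticToContinuum.BoseEinsteinCondensation.Theorems

end
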